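import Mathlib
import HarnessLib
import Literature.Analysis.FluidPDE.ParabolicComparison
import Literature.Analysis.FluidPDE.RadialCalculus

/-!
# Route `PoloidalWindowDoor`, crux `PoloidalWindowRigidity` (K2, stmt-NavierStokesRegularity-19708) — kernel tool:
# the weak maximum principle on a MOVING BALL and the moving quartic barrier (towards the strong maximum principle)

Cell ns-regularity-ideate, seat nsreg-p7 gen 5 (third worker under the K2 lead ns-poloidal-K2-p1; file landed
`--supports stmt-NavierStokesRegularity-19708`).  First half of the kernel proof of the PARABOLIC STRONG MAXIMUM
PRINCIPLE for bounded-drift sub-solutions on whole-space slabs (companion file `…StrongMaxPrinciple`), in the classical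
pointwise setting of the tree's weak principles (`…BoundedSubsolutionMaxPrinciple.le_of_bounded_subsolution`,
`…WholeSpaceComparison.sign_mul_le_of_superBarrier`, `Literature…ParabolicComparison.paraboloid_comparison`):

* `deriv_nonneg_of_isMaxOn_left` — first-order condition at a left maximum;
* `movingBall_maxPrinciple` — weak maximum principle on a MOVING BALL `{‖x − (x₁ + (t − t₁)ξ)‖ ≤ r}` (a slanted
  cylinder): a classical sub-solution of `∂ₜu + Du(b) − Δu ≤ 0` inside that is `≤ 0` on the bottom ball and on the
  moving sphere is `≤ 0` (Lieberman 1996 Ch. II Lemma 2.1/2.3: a positive maximum of `u − θ(t − t₁)` on the compact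
  region lies inside, where `Du = 0`, `Δu ≤ 0`, `∂ₜu ≥ θ`);
* the moving quartic bump `η = δ e^{−Λ(t−t₁)} (r² − ‖x − x₁ − (t−t₁)ξ‖²)²`: spatial derivative (`hasFDerivAt_bump`,
  `fderiv_bump_apply`), Laplacian on `ℝ³` (`laplacian_bump`: `κ(8‖y‖² − 12ρ)`, `ρ = r² − ‖y‖²`), time derivative
  (`hasDerivAt_movingBump`: `δe^{−Λs}(−Λρ² + 4ρ⟪y, ξ⟫)`), and
* `movingBump_law` — **the bump is a classical SUB-solution inside the moving ball for every drift bounded by `A`**, once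
  `32 Λ r² ≥ (4 r (A + ‖ξ‖) + 20)²`: `Lη = δe^{−Λs}[−Λρ² + 4ρ⟪y, ξ − b⟫ + 12ρ − 8‖y‖²] ≤ 0` (a concave quadratic in
  `ρ` with negative discriminant).

WHAT THIS IS NOT: not a claim about Navier–Stokes — linear parabolic lemmas (bears_on LADDER-NS N0, route
PoloidalWindowDoor, crux K2).
-/

noncomputable section

-- the summit and its single sub-problem share the name (CONVENTIONS §1), as in every Theorems file
set_option linter.dupNamespace false

namespace Summit.NavierStokesRegularity.NavierStokesRegularity.Theorems.PoloidalWindowDoorPoloidalWindowRigidityMovingBallMaxPrinciple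

open MeasureTheory Set Function Filter Topology TopologicalSpace Metric InnerProductSpace
open scoped RealInnerProductSpace InnerProductSpace Laplacian ContDiff
open Literature.Analysis Literature.Analysis.FluidPDE

/-! ### First-order condition at a left maximum -/

/-- If `f ≤ f(b)` on `[a, b]` (`a < b`) and `f` has derivative `D` at `b`, then `0 ≤ D`. [folklore] -/
theorem deriv_nonneg_of_isMaxOn_left {f : ℝ → ℝ} {D a b : ℝ} (hab : a < b) (hf : HasDerivAt f D b)
    (hmax : ∀ s ∈ Icc a b, f s ≤ f b) : 0 ≤ D := by
  have hloc : IsLocalMaxOn f (Icc a b) b := IsMaxOn.localize (fun s hs => hmax s hs)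
  have hy : (a - b : ℝ) ∈ posTangentConeAt (Icc a b) b := by
    refine mem_posTangentConeAt_of_segment_subset ?_
    rw [add_sub_cancel]
    exact (convex_Icc a b).segment_subset (right_mem_Icc.2 hab.le) (left_mem_Icc.2 hab.le)
  have h := hloc.hasFDerivWithinAt_nonpos (hf.hasDerivWithinAt (s := Icc a b)).hasFDerivWithinAt hy
  rw [ContinuousLinearMap.toSpanSingleton_apply, smul_eq_mul] at h
  nlinarith

/-! ### Weak maximum principle on a moving ball -/

/-- **Weak maximum principle on a moving ball** (slanted cylinder).  Let `c(t) = x₁ + (t − t₁)ξ`.  A function `u`,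
jointly continuous on `[t₁, t₂] × ℝ³` with `C²` slices and a classical time derivative `ut`, satisfying
`ut + Du(b) − Δu ≤ 0` at the points `t ∈ (t₁, t₂]`, `‖x − c(t)‖ < r`, and `u ≤ 0` on the bottom ball `‖x − x₁‖ ≤ r`
and on the moving sphere `‖x − c(t)‖ = r`, satisfies `u ≤ 0` on the whole moving ball.
[cite: Lieberman1996, Ch. II Lemma 2.1, Lemma 2.3 (pp. 7–10)] -/
theorem movingBall_maxPrinciple {b : ℝ → EuclideanSpace ℝ (Fin 3) → EuclideanSpace ℝ (Fin 3)}
    {u ut : ℝ → EuclideanSpace ℝ (Fin 3) → ℝ} {t₁ t₂ r : ℝ} (h12 : t₁ ≤ t₂)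
    (x₁ ξ : EuclideanSpace ℝ (Fin 3))
    (hu_c : ContinuousOn (uncurry u) (Icc t₁ t₂ ×ˢ univ))
    (hu2 : ∀ t ∈ Icc t₁ t₂, ContDiff ℝ 2 (u t))
    (hut : ∀ x, ∀ t ∈ Icc t₁ t₂, HasDerivAt (fun τ => u τ x) (ut t x) t)
    (hlaw : ∀ t ∈ Ioc t₁ t₂, ∀ x, ‖x - (x₁ + (t - t₁) • ξ)‖ < r →
      ut t x + fderiv ℝ (u t) x (b t x) - (Δ (u t)) x ≤ 0)
    (hbot : ∀ x, ‖x - x₁‖ ≤ r → u t₁ x ≤ 0)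
    (hside : ∀ t ∈ Icc t₁ t₂, ∀ x, ‖x - (x₁ + (t - t₁) • ξ)‖ = r → u t x ≤ 0) :
    ∀ t ∈ Icc t₁ t₂, ∀ x, ‖x - (x₁ + (t - t₁) • ξ)‖ ≤ r → u t x ≤ 0 := by
  -- the moving centre and the compact region
  set c : ℝ → EuclideanSpace ℝ (Fin 3) := fun t => x₁ + (t - t₁) • ξ with hc
  have hcc : Continuous c := continuous_const.add ((continuous_id.sub continuous_const).smul continuous_const)
  have hc1 : c t₁ = x₁ := by simp [hc]
  set K : Set (ℝ × EuclideanSpace ℝ (Fin 3)) := {p | p.1 ∈ Icc t₁ t₂ ∧ ‖p.2 - c p.1‖ ≤ r} with hK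
  have hdist : Continuous fun p : ℝ × EuclideanSpace ℝ (Fin 3) => ‖p.2 - c p.1‖ :=
    (continuous_snd.sub (hcc.comp continuous_fst)).norm
  have hKclosed : IsClosed K :=
    (isClosed_Icc.preimage continuous_fst).inter (isClosed_le hdist continuous_const)
  have hKsub : K ⊆ Icc t₁ t₂ ×ˢ closedBall x₁ (|r| + (t₂ - t₁) * ‖ξ‖) := by
    rintro ⟨t, x⟩ ⟨ht, hx⟩
    refine ⟨ht, ?_⟩
    rw [mem_closedBall, dist_eq_norm]
    have h1 : ‖c t - x₁‖ ≤ (t₂ - t₁) * ‖ξ‖ := by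
      have : c t - x₁ = (t - t₁) • ξ := by simp [hc]
      rw [this, norm_smul, Real.norm_eq_abs, abs_of_nonneg (by linarith [ht.1])]
      exact mul_le_mul_of_nonneg_right (by linarith [ht.2]) (norm_nonneg _)
    calc ‖x - x₁‖ = ‖(x - c t) + (c t - x₁)‖ := by congr 1; abel
      _ ≤ ‖x - c t‖ + ‖c t - x₁‖ := norm_add_le _ _
      _ ≤ |r| + (t₂ - t₁) * ‖ξ‖ := add_le_add (hx.trans (le_abs_self r)) h1
  have hKc : IsCompact K :=
    (isCompact_Icc.prod (isCompact_closedBall _ _)).of_isClosed_subset hKclosed hKsub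
  have hKmem : ∀ {t : ℝ} {x : EuclideanSpace ℝ (Fin 3)}, t ∈ Icc t₁ t₂ → ‖x - c t‖ ≤ r → (t, x) ∈ K :=
    fun ht hx => ⟨ht, hx⟩
  -- the claim for every `θ > 0`
  have main : ∀ θ : ℝ, 0 < θ → ∀ p ∈ K, u p.1 p.2 - θ * (p.1 - t₁) ≤ 0 := by
    intro θ hθ
    set w : ℝ × EuclideanSpace ℝ (Fin 3) → ℝ := fun p => u p.1 p.2 - θ * (p.1 - t₁) with hw
    have hKsub' : K ⊆ Icc t₁ t₂ ×ˢ univ := by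
      rintro ⟨t, x⟩ ⟨ht, -⟩; exact ⟨ht, mem_univ _⟩
    have hwc : ContinuousOn w K :=
      (hu_c.mono hKsub').sub (continuous_const.mul (continuous_fst.sub continuous_const)).continuousOn
    by_contra hcon
    push Not at hcon
    obtain ⟨p₁, hp₁K, hp₁⟩ := hcon
    obtain ⟨X, hXK, hXmax⟩ := hKc.exists_isMaxOn ⟨p₁, hp₁K⟩ hwc
    have hXpos : 0 < w X := hp₁.trans_le (hXmax hp₁K)
    obtain ⟨ts, xs⟩ := X
    obtain ⟨htsI, hxs⟩ := hXK
    -- not on the bottom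
    have hts_ne : ts ≠ t₁ := by
      intro h
      subst h
      have h1 : ‖xs - x₁‖ ≤ r := by simpa [hc1] using hxs
      have := hbot xs h1
      simp [hw] at hXpos
      linarith
    have hts_gt : t₁ < ts := lt_of_le_of_ne htsI.1 (Ne.symm hts_ne)
    have htsIoc : ts ∈ Ioc t₁ t₂ := ⟨hts_gt, htsI.2⟩
    -- not on the side
    have hxs_lt : ‖xs - c ts‖ < r := by
      refine lt_of_le_of_ne hxs fun h => ?_
      have h1 := hside ts htsI xs h
      have h2 : 0 ≤ θ * (ts - t₁) := mul_nonneg hθ.le (by linarith)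
      simp [hw] at hXpos
      linarith
    -- spatial local maximum at `xs`
    set W : EuclideanSpace ℝ (Fin 3) → ℝ := fun x => u ts x - θ * (ts - t₁) with hW
    have hW2 : ContDiff ℝ 2 W := (hu2 ts htsI).sub contDiff_const
    have hWmax : IsLocalMax W xs := by
      have hU : {x : EuclideanSpace ℝ (Fin 3) | ‖x - c ts‖ < r} ∈ 𝓝 xs :=
        (isOpen_lt (continuous_id.sub continuous_const).norm continuous_const).mem_nhds hxs_lt
      filter_upwards [hU] with x hx
      exact hXmax (hKmem htsI hx.le)
    have hDW : fderiv ℝ W xs = 0 := IsLocalMax.fderiv_eq_zero hWmax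
    have hΔW : (Δ W) xs ≤ 0 := IsLocalMax.laplacian_nonpos hW2 hWmax
    have hud : DifferentiableAt ℝ (u ts) xs := (hu2 ts htsI).differentiable two_ne_zero xs
    have hDu : fderiv ℝ (u ts) xs = 0 := by
      have h1 : fderiv ℝ W xs = fderiv ℝ (u ts) xs := by
        rw [hW, fderiv_sub_const]
      rw [← h1, hDW]
    have hΔu : (Δ (u ts)) xs ≤ 0 := by
      have h1 : W = (u ts) - fun _ => θ * (ts - t₁) := by funext x; simp [hW]
      have h2 : (Δ W) xs = (Δ (u ts)) xs := by
        rw [h1, (hu2 ts htsI).contDiffAt.laplacian_sub contDiffAt_const, laplacian_const]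
        simp
      rw [← h2]; exact hΔW
    -- temporal: `xs` stays inside the moving ball for times slightly below `ts`
    obtain ⟨δ₂, hδ₂, hins⟩ : ∃ δ₂ > 0, ∀ τ, dist τ ts < δ₂ → ‖xs - c τ‖ < r := by
      have hev : ∀ᶠ τ in 𝓝 ts, ‖xs - c τ‖ < r :=
        ((continuous_const.sub hcc).norm.continuousAt).eventually (gt_mem_nhds hxs_lt)
      rw [Metric.eventually_nhds_iff] at hev
      exact hev
    set δ : ℝ := min δ₂ (ts - t₁) / 2 with hδ
    have hδpos : 0 < δ := by
      have : 0 < min δ₂ (ts - t₁) := lt_min hδ₂ (by linarith)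
      rw [hδ]; linarith
    have hδ2 : δ < δ₂ := by
      have : min δ₂ (ts - t₁) ≤ δ₂ := min_le_left _ _
      rw [hδ]; linarith
    have hδ3 : δ < ts - t₁ := by
      have : min δ₂ (ts - t₁) ≤ ts - t₁ := min_le_right _ _
      rw [hδ]; linarith
    -- the one-variable function `f τ = u τ xs − θ (τ − t₁)` has a left maximum at `ts`
    have hfmax : ∀ τ ∈ Icc (ts - δ) ts, u τ xs - θ * (τ - t₁) ≤ u ts xs - θ * (ts - t₁) := by
      intro τ hτ
      have hτI : τ ∈ Icc t₁ t₂ := ⟨by linarith [hτ.1], hτ.2.trans htsI.2⟩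
      have hd : dist τ ts < δ₂ := by
        rw [Real.dist_eq, abs_sub_comm, abs_of_nonneg (by linarith [hτ.2])]
        linarith [hτ.1]
      exact hXmax (hKmem hτI (hins τ hd).le)
    have hfd : HasDerivAt (fun τ => u τ xs - θ * (τ - t₁)) (ut ts xs - θ) ts := by
      have h1 := hut xs ts htsI
      have h2 : HasDerivAt (fun τ : ℝ => θ * (τ - t₁)) θ ts := by
        simpa using ((hasDerivAt_id ts).sub_const t₁).const_mul θ
      exact h1.sub h2
    have hut_ge : 0 ≤ ut ts xs - θ :=
      deriv_nonneg_of_isMaxOn_left (a := ts - δ) (by linarith) hfd hfmax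
    -- contradiction with the differential inequality at `(ts, xs)`
    have hl := hlaw ts htsIoc xs hxs_lt
    rw [hDu] at hl
    simp only [zero_apply] at hl
    linarith
  -- `θ → 0`
  intro t ht x hx
  by_contra hcon
  push Not at hcon
  set d : ℝ := u t x with hd
  have hdpos : 0 < d := hcon
  have h := main (d / (2 * (t₂ - t₁) + 2)) (by positivity) (t, x) (hKmem ht hx)
  simp only at h
  have h3 : d / (2 * (t₂ - t₁) + 2) * (t - t₁) ≤ d / 2 := by
    rw [div_mul_eq_mul_div, div_le_iff₀ (by linarith [ht.1, ht.2] : (0 : ℝ) < 2 * (t₂ - t₁) + 2)]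
    have h4 : t - t₁ ≤ t₂ - t₁ := by linarith [ht.2]
    have h5 : 0 ≤ t - t₁ := by linarith [ht.1]
    nlinarith
  linarith


/-! ### The moving quartic bump `η = δ e^{−Λ(t−t₁)} (r² − ‖x − x₁ − (t − t₁)ξ‖²)²` -/

/-- Spatial differentiability of the quartic bump `κ (r² − ‖· − c‖²)²`, with its derivative. [folklore] -/
theorem hasFDerivAt_bump (κ r : ℝ) (c x : EuclideanSpace ℝ (Fin 3)) :
    HasFDerivAt (fun y : EuclideanSpace ℝ (Fin 3) => κ * (r ^ 2 - ‖y - c‖ ^ 2) ^ 2)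
      (κ • (((2 : ℕ) • (r ^ 2 - ‖x - c‖ ^ 2) ^ (2 - 1)) •
        -((2 : ℕ) • ((innerSL ℝ (x - c)).comp (ContinuousLinearMap.id ℝ (EuclideanSpace ℝ (Fin 3))))))) x := by
  have h0 : HasFDerivAt (fun y : EuclideanSpace ℝ (Fin 3) => y - c)
      (ContinuousLinearMap.id ℝ (EuclideanSpace ℝ (Fin 3))) x := (hasFDerivAt_id x).sub_const c
  exact ((h0.norm_sq.const_sub (r ^ 2)).pow 2).const_mul κ

/-- The quartic bump is `C^∞` in space. [folklore] -/
theorem contDiff_bump (κ r : ℝ) (c : EuclideanSpace ℝ (Fin 3)) {n : WithTop ℕ∞} :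
    ContDiff ℝ n (fun y : EuclideanSpace ℝ (Fin 3) => κ * (r ^ 2 - ‖y - c‖ ^ 2) ^ 2) :=
  contDiff_const.mul ((contDiff_const.sub ((contDiff_id.sub contDiff_const).norm_sq ℝ)).pow 2)

/-- `fderiv` of the quartic bump applied to a vector:
`D[κ (r² − ‖· − c‖²)²](x) v = −4 κ (r² − ‖x − c‖²) ⟪x − c, v⟫`. [folklore] -/
theorem fderiv_bump_apply (κ r : ℝ) (c x v : EuclideanSpace ℝ (Fin 3)) :
    fderiv ℝ (fun y : EuclideanSpace ℝ (Fin 3) => κ * (r ^ 2 - ‖y - c‖ ^ 2) ^ 2) x v =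
      -(4 * κ * (r ^ 2 - ‖x - c‖ ^ 2)) * ⟪x - c, v⟫_ℝ := by
  rw [(hasFDerivAt_bump κ r c x).fderiv]
  simp only [smul_apply, neg_apply, ContinuousLinearMap.coe_comp, Function.comp_apply,
    ContinuousLinearMap.coe_id', id_eq, innerSL_apply_apply, smul_eq_mul, nsmul_eq_mul, Nat.cast_ofNat,
    show (2 : ℕ) - 1 = 1 from rfl, pow_one, smul_neg, neg_mul]
  ring

/-- Translation commutes with the Laplacian (local copy of the folklore lemma). [folklore] -/
theorem laplacian_comp_sub (G : EuclideanSpace ℝ (Fin 3) → ℝ) (c x : EuclideanSpace ℝ (Fin 3)) :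
    (Δ (fun y => G (y - c))) x = (Δ G) (x - c) := by
  rw [laplacian_eq_iteratedFDeriv_stdOrthonormalBasis, laplacian_eq_iteratedFDeriv_stdOrthonormalBasis]
  simp only [iteratedFDeriv_comp_sub]

/-- Laplacian of the quartic bump on `ℝ³`: `Δ[κ (r² − ‖· − c‖²)²](x) = κ (8 ‖x − c‖² − 12 (r² − ‖x − c‖²))`.
[folklore] -/
theorem laplacian_bump (κ r : ℝ) (c x : EuclideanSpace ℝ (Fin 3)) :
    (Δ (fun y : EuclideanSpace ℝ (Fin 3) => κ * (r ^ 2 - ‖y - c‖ ^ 2) ^ 2)) x =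
      κ * (8 * ‖x - c‖ ^ 2 - 12 * (r ^ 2 - ‖x - c‖ ^ 2)) := by
  set G : EuclideanSpace ℝ (Fin 3) → ℝ := fun y => κ * (r ^ 2 - ‖y‖ ^ 2) ^ 2 with hG
  have hfun : (fun y : EuclideanSpace ℝ (Fin 3) => κ * (r ^ 2 - ‖y - c‖ ^ 2) ^ 2) = fun y => G (y - c) := by
    funext y; simp [hG]
  rw [hfun, laplacian_comp_sub]
  -- radial calculus: `G = g ∘ ‖·‖²`, `g σ = κ (r² − σ)²`
  have hg : ∀ σ ∈ (univ : Set ℝ), HasDerivAt (fun σ : ℝ => κ * (r ^ 2 - σ) ^ 2) (-2 * κ * (r ^ 2 - σ)) σ := by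
    intro σ _
    have h1 : HasDerivAt (fun σ : ℝ => r ^ 2 - σ) (-1) σ := by
      simpa using (hasDerivAt_id σ).const_sub (r ^ 2)
    have h3 := (h1.fun_pow 2).const_mul κ
    refine h3.congr_deriv ?_
    simp only [Nat.cast_ofNat, show (2 : ℕ) - 1 = 1 from rfl, pow_one]
    ring
  have hg₁ : HasDerivAt (fun σ : ℝ => -2 * κ * (r ^ 2 - σ)) (2 * κ) (‖x - c‖ ^ 2) := by
    have h := ((hasDerivAt_id (‖x - c‖ ^ 2)).const_sub (r ^ 2)).const_mul (-2 * κ)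
    refine h.congr_deriv ?_
    ring
  have h := laplacian_comp_norm_sq (E := EuclideanSpace ℝ (Fin 3)) (g := fun σ : ℝ => κ * (r ^ 2 - σ) ^ 2)
    (g₁ := fun σ : ℝ => -2 * κ * (r ^ 2 - σ)) (g₂ := 2 * κ) isOpen_univ hg (mem_univ (‖x - c‖ ^ 2)) hg₁
  rw [finrank_euclideanSpace_fin] at h
  rw [show G = fun w : EuclideanSpace ℝ (Fin 3) => (fun σ : ℝ => κ * (r ^ 2 - σ) ^ 2) (‖w‖ ^ 2) from rfl, h]
  push_cast
  ring

/-- The moving similarity variable `y(τ) = x − (x₁ + (τ − t₁)ξ)` has time derivative `−ξ`. [folklore] -/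
theorem hasDerivAt_movingPoint (x x₁ ξ : EuclideanSpace ℝ (Fin 3)) (t₁ τ : ℝ) :
    HasDerivAt (fun σ : ℝ => x - (x₁ + (σ - t₁) • ξ)) (-ξ) τ := by
  have h1 : HasDerivAt (fun σ : ℝ => (σ - t₁) • ξ) ((1 : ℝ) • ξ) τ := ((hasDerivAt_id τ).sub_const t₁).smul_const ξ
  rw [one_smul] at h1
  have h2 := (h1.const_add x₁).const_sub x
  exact h2

/-- Time derivative of the moving bump:
`∂τ[δ e^{−Λ(τ−t₁)} (r² − ‖y(τ)‖²)²] = δ e^{−Λ(τ−t₁)} (−Λ ρ² + 4 ρ ⟪y, ξ⟫)`, `ρ = r² − ‖y‖²`. [folklore] -/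
theorem hasDerivAt_movingBump (δ Λ r t₁ : ℝ) (x x₁ ξ : EuclideanSpace ℝ (Fin 3)) (τ : ℝ) :
    HasDerivAt (fun σ : ℝ => δ * Real.exp (-Λ * (σ - t₁)) * (r ^ 2 - ‖x - (x₁ + (σ - t₁) • ξ)‖ ^ 2) ^ 2)
      (δ * Real.exp (-Λ * (τ - t₁)) *
        (-Λ * (r ^ 2 - ‖x - (x₁ + (τ - t₁) • ξ)‖ ^ 2) ^ 2 +
          4 * (r ^ 2 - ‖x - (x₁ + (τ - t₁) • ξ)‖ ^ 2) * ⟪x - (x₁ + (τ - t₁) • ξ), ξ⟫_ℝ)) τ := by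
  have hy := hasDerivAt_movingPoint x x₁ ξ t₁ τ
  have hn := hy.norm_sq
  have hρ := (hn.const_sub (r ^ 2)).mul (hn.const_sub (r ^ 2))
  have he : HasDerivAt (fun σ : ℝ => Real.exp (-Λ * (σ - t₁))) (Real.exp (-Λ * (τ - t₁)) * (-Λ * 1)) τ :=
    (((hasDerivAt_id τ).sub_const t₁).const_mul (-Λ)).exp
  have h := ((he.mul hρ).const_mul δ)
  refine (h.congr_of_eventuallyEq ?_).congr_deriv ?_
  · exact Eventually.of_forall fun σ => by simp only [Pi.mul_apply]; ring
  · simp only [inner_neg_right, mul_one, Pi.mul_apply]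
    ring

/-- **The moving bump is a sub-solution inside the moving ball.**  With `y = x − (x₁ + (t − t₁)ξ)`,
`ρ = r² − ‖y‖²`, `η = δ e^{−Λ(t−t₁)} ρ²` and any vector `β` with `‖β‖ ≤ A`: if `δ ≥ 0`, `r > 0`, `‖y‖ ≤ r` and
`32 Λ r² ≥ (4 r (A + ‖ξ‖) + 20)²`, then `ηₜ + Dη(β) − Δη ≤ 0`
(`= δe^{−Λs}[−Λρ² + 4ρ⟪y, ξ − β⟫ + 12ρ − 8‖y‖²]`, a concave quadratic in `ρ` with negative discriminant). [folklore] -/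
theorem movingBump_law {δ Λ r A t₁ t : ℝ} {x x₁ ξ β : EuclideanSpace ℝ (Fin 3)} (hδ : 0 ≤ δ) (hr : 0 < r)
    (hA : ‖β‖ ≤ A) (hΛ : (4 * r * (A + ‖ξ‖) + 20) ^ 2 ≤ 32 * Λ * r ^ 2)
    (hin : ‖x - (x₁ + (t - t₁) • ξ)‖ ≤ r) :
    δ * Real.exp (-Λ * (t - t₁)) *
        (-Λ * (r ^ 2 - ‖x - (x₁ + (t - t₁) • ξ)‖ ^ 2) ^ 2 +
          4 * (r ^ 2 - ‖x - (x₁ + (t - t₁) • ξ)‖ ^ 2) * ⟪x - (x₁ + (t - t₁) • ξ), ξ⟫_ℝ) +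
      fderiv ℝ (fun y : EuclideanSpace ℝ (Fin 3) =>
        δ * Real.exp (-Λ * (t - t₁)) * (r ^ 2 - ‖y - (x₁ + (t - t₁) • ξ)‖ ^ 2) ^ 2) x β -
      (Δ (fun y : EuclideanSpace ℝ (Fin 3) =>
        δ * Real.exp (-Λ * (t - t₁)) * (r ^ 2 - ‖y - (x₁ + (t - t₁) • ξ)‖ ^ 2) ^ 2)) x ≤ 0 := by
  set κ : ℝ := δ * Real.exp (-Λ * (t - t₁)) with hκ
  set y : EuclideanSpace ℝ (Fin 3) := x - (x₁ + (t - t₁) • ξ) with hy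
  set ρ : ℝ := r ^ 2 - ‖y‖ ^ 2 with hρ
  rw [fderiv_bump_apply, laplacian_bump]
  have hκ0 : 0 ≤ κ := mul_nonneg hδ (Real.exp_nonneg _)
  have hA0 : 0 ≤ A := (norm_nonneg _).trans hA
  have hρ0 : 0 ≤ ρ := by
    rw [hρ, sub_nonneg]
    exact pow_le_pow_left₀ (norm_nonneg _) hin 2
  -- the drift/boost term: `4ρ⟪y, ξ − β⟫ ≤ 4ρ r (A + ‖ξ‖)`
  have hinner : ⟪y, ξ⟫_ℝ - ⟪y, β⟫_ℝ ≤ r * (A + ‖ξ‖) := by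
    rw [← inner_sub_right]
    calc ⟪y, ξ - β⟫_ℝ ≤ ‖y‖ * ‖ξ - β‖ := real_inner_le_norm _ _
      _ ≤ r * (‖ξ‖ + ‖β‖) := mul_le_mul hin (norm_sub_le _ _) (norm_nonneg _) hr.le
      _ ≤ r * (A + ‖ξ‖) := by nlinarith [norm_nonneg ξ]
  -- the bracket as a concave quadratic in `ρ`
  set B : ℝ := 4 * r * (A + ‖ξ‖) + 20 with hB
  have hB0 : 0 < B := by rw [hB]; positivity
  have hΛ0 : 0 < Λ := by
    by_contra h
    push Not at h
    have : 32 * Λ * r ^ 2 ≤ 0 := by nlinarith [sq_nonneg r]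
    nlinarith [sq_nonneg B, hB0]
  have hysq : ‖y‖ ^ 2 = r ^ 2 - ρ := by rw [hρ]; ring
  have hquad : -Λ * ρ ^ 2 + B * ρ - 8 * r ^ 2 ≤ 0 := by
    nlinarith [sq_nonneg (2 * Λ * ρ - B)]
  have hbr : -Λ * ρ ^ 2 + 4 * ρ * ⟪y, ξ⟫_ℝ + -(4 * ρ) * ⟪y, β⟫_ℝ - (8 * ‖y‖ ^ 2 - 12 * ρ) ≤ 0 := by
    have h1 : 4 * ρ * ⟪y, ξ⟫_ℝ + -(4 * ρ) * ⟪y, β⟫_ℝ ≤ 4 * ρ * (r * (A + ‖ξ‖)) := by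
      have := mul_le_mul_of_nonneg_left hinner (by positivity : (0 : ℝ) ≤ 4 * ρ)
      linarith
    rw [hysq]
    have h2 : 4 * ρ * (r * (A + ‖ξ‖)) + 12 * ρ + 8 * ρ = B * ρ := by rw [hB]; ring
    nlinarith
  have key : κ * (-Λ * ρ ^ 2 + 4 * ρ * ⟪y, ξ⟫_ℝ) + -(4 * κ * ρ) * ⟪y, β⟫_ℝ - κ * (8 * ‖y‖ ^ 2 - 12 * ρ) =
      κ * (-Λ * ρ ^ 2 + 4 * ρ * ⟪y, ξ⟫_ℝ + -(4 * ρ) * ⟪y, β⟫_ℝ - (8 * ‖y‖ ^ 2 - 12 * ρ)) := by ring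
  rw [key]
  exact mul_nonpos_of_nonneg_of_nonpos hκ0 hbr

end Summit.NavierStokesRegularity.NavierStokesRegularity.Theorems.PoloidalWindowDoorPoloidalWindowRigidityMovingBallMaxPrinciple

end
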